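import Literature.Topology.FourManifolds.SmoothMax
import Literature.Topology.FourManifolds.RegularFamilyIsotopy
import HarnessLib

/-!
# The sweep lemma: cutting a compact regular domain along a sweep function

Topic `Literature/Topology/FourManifolds`; fourth brick of the exp-height line of the fact seat
`provefact-Literature.Topology.FourManifolds.SphereEmbedding.schoenflies_exists_ball`
(Alexander's theorem, Schultens (2014), Thm. 3.2.5), built on `SmoothMax.lean` and
`RegularFamilyIsotopy.lean`.  **Everything in this file is proved; no definitions, no named
facts.**

The absorption moves of Alexander's argument — Schultens' Lemma 3.2.3 ("`(S₁ - D₁) ∪ D₂` is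
isotopic to `S₁`") and the case `k = 0` of the proof of Thm. 3.2.5, where the ball between a
level disc and a saddle-free disc of the sphere is pushed across — are realised on the level of
*regions*: the part of the compact regular domain `A = {F ≤ 0}` lying below the level `{w = 1}`
of a *sweep function* `w` is cut away through the regular family of domains
`A_τ = {F ⊔_δ (τ - w) ≤ 0}` (smooth maximum of `SmoothMax.lean`), which the isotopy lemma
`RegularFamily.exists_diffeomorph_image_eq` integrates to an ambient diffeomorphism.

* `SmoothMax.exists_diffeomorph_image_sweep` — **the sweep lemma**: if `DF ≠ 0` on the collar
  `{-2δ ≤ F ≤ 0}`, `Dw ≠ 0` on `A ∩ {w ≤ 1 + 2δ}`, and on the collar part of that set `Dw` is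
  never a positive multiple of `DF` (the gradient of the sweep function never points straight
  out of `A`), then for every admissible positive part `P` there is a diffeomorphism `Φ` of the
  ambient space with `Φ(A) = {F ⊔_δ (1 - w) ≤ 0}`, `Φ(∂A) = {F ⊔_δ (1 - w) = 0}`, `Φ = id`
  off the compact `K ⊇ {F ≤ ε₀}` and on `{w + F ≥ 1 + δ}`.
* `SmoothMax.deriv_eq_zero_of_le`, `SmoothMax.deriv_eq_one_of_le` — an admissible profile has
  `P' = 0` on `(-∞, -1]` and `P' = 1` on `[1, ∞)`.

In the application `w` is an affine function of the height near the piece to be absorbed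
(pushed above `1 + 2δ` elsewhere), and the hypothesis on the collar says that no point of the
boundary of that piece below the cutting level has outward normal pointing straight up — the
situation of a saddle-free disc in Schultens' case `k = 0`.

## References

* J. Schultens, *Introduction to 3-Manifolds*, GSM 151 (2014), Lemma 3.2.3 and Thm. 3.2.5
  (PDF pp. 42–45). [Schultens2014]
* J. Milnor, *Morse theory*, Ann. of Math. Studies 51 (1963), Thm. 3.1. [Milnor1963]
-/

open scoped RealInnerProductSpace Topology Manifold ContDiff
open Set Filter Metric Function

noncomputable section

namespace Literature.Topology.FourManifolds

namespace SmoothMax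

/-! ### §1 The derivative of an admissible profile off the band -/

/-- For an admissible profile, `P' = 0` on `(-∞, -1]` (there `P ≥ 0 = P(s)` has a local
minimum). [folklore] -/
theorem deriv_eq_zero_of_le {P : ℝ → ℝ} (hP0 : ∀ s, s ≤ -1 → P s = 0)
    (hPge : ∀ s, max 0 s ≤ P s) {s : ℝ} (hs : s ≤ -1) : deriv P s = 0 := by
  apply IsLocalMin.deriv_eq_zero
  filter_upwards with t
  rw [hP0 s hs]
  exact le_trans (le_max_left _ _) (hPge t)

/-- For an admissible profile, `P' = 1` on `[1, ∞)` (there `P - id ≥ 0 = (P - id)(s)` has a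
local minimum). [folklore] -/
theorem deriv_eq_one_of_le {P : ℝ → ℝ} (hPd : Differentiable ℝ P) (hP1 : ∀ s, 1 ≤ s → P s = s)
    (hPge : ∀ s, max 0 s ≤ P s) {s : ℝ} (hs : 1 ≤ s) : deriv P s = 1 := by
  have hmin : IsLocalMin (fun t => P t - t) s := by
    filter_upwards with t
    rw [hP1 s hs, sub_self, sub_nonneg]
    exact le_trans (le_max_right _ _) (hPge t)
  have h := hmin.deriv_eq_zero
  have hd : HasDerivAt (fun t => P t - t) (deriv P s - 1) s :=
    (hPd s).hasDerivAt.sub (hasDerivAt_id s)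
  rw [hd.deriv] at h
  linarith

/-! ### §2 The sweep lemma -/

section Sweep

variable {E : Type*} [NormedAddCommGroup E] [InnerProductSpace ℝ E] [FiniteDimensional ℝ E]

/-- **The sweep lemma.**  Let `A = {F ≤ 0}` be a compact regular domain (`F` smooth,
`{F ≤ ε₀} ⊆ K` compact, `DF ≠ 0` on the collar `{-2δ ≤ F ≤ 0}`) and `w` a smooth *sweep
function*: on `A ∩ {w ≤ 1 + 2δ}` it has no critical points, and on the collar part of that
region its derivative is never a positive multiple of `DF` (the gradient of `w` never points
straight out of `A`).  Then, for every admissible smooth positive part `P`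
(`SmoothMax.exists_smoothPosPart`), the region obtained from `A` by cutting away `{w < 1}` and
rounding, `A' = {F ⊔_δ (1 - w) ≤ 0}` with `F ⊔_δ ℓ = F + δ P((ℓ - F)/δ)`, is the image of `A`
under a diffeomorphism `Φ` of `E` which also carries `∂A = {F = 0}` onto `{F ⊔_δ (1 - w) = 0}`,
fixes every point outside `K` and every point with `w + F ≥ 1 + δ`.  Proof: the family
`F_τ = F ⊔_δ (τ - w)`, `τ₀ ≤ τ ≤ 1` (`τ₀ ≤ min_A (F + w) - δ`, so that `F_{τ₀}` defines `A`
exactly), is a regular family of compact domains — at a zero of `F_τ` the derivative is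
`(1 - θ) DF - θ Dw`, `θ = P' ∈ [0, 1]`, with `θ = 0` where `F_τ = F` and `θ = 1` where
`F_τ = τ - w` — and `RegularFamily.exists_diffeomorph_image_eq` applies.  This is the
function-theoretic form of the absorption moves in Alexander's theorem (Schultens (2014),
Lemma 3.2.3 and the case `k = 0` of the proof of Thm. 3.2.5: sweeping a region by the level
sets of the height). [folklore] -/
theorem exists_diffeomorph_image_sweep {P : ℝ → ℝ} (hP : ContDiff ℝ ∞ P)
    (hP0 : ∀ s, s ≤ -1 → P s = 0) (hP1 : ∀ s, 1 ≤ s → P s = s)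
    (hPd : ∀ s, 0 ≤ deriv P s ∧ deriv P s ≤ 1) (hPge : ∀ s, max 0 s ≤ P s)
    (hPle : ∀ s, P s ≤ max 0 s + 1)
    {F w : E → ℝ} (hF : ContDiff ℝ ∞ F) (hw : ContDiff ℝ ∞ w) {K : Set E} (hK : IsCompact K)
    {ε₀ : ℝ} (hε₀ : 0 < ε₀) (hKF : ∀ x, F x ≤ ε₀ → x ∈ K) {δ : ℝ} (hδ : 0 < δ)
    (H1 : ∀ x, -(2 * δ) ≤ F x → F x ≤ 0 → fderiv ℝ F x ≠ 0)
    (H2 : ∀ x, F x ≤ 0 → w x ≤ 1 + 2 * δ → fderiv ℝ w x ≠ 0)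
    (H3 : ∀ x, -(2 * δ) ≤ F x → F x ≤ 0 → w x ≤ 1 + 2 * δ → ∀ c : ℝ, 0 < c →
      fderiv ℝ w x ≠ c • fderiv ℝ F x) :
    ∃ Φ : E ≃ₘ⟮𝓘(ℝ, E), 𝓘(ℝ, E)⟯ E,
      Φ '' {x | F x ≤ 0} = {x | F x + δ * P ((1 - w x - F x) / δ) ≤ 0} ∧
      Φ '' {x | F x = 0} = {x | F x + δ * P ((1 - w x - F x) / δ) = 0} ∧
      (∀ x, 1 + δ ≤ w x + F x → Φ x = x) ∧ (∀ x, x ∉ K → Φ x = x) := by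
  have hPdiff : Differentiable ℝ P := hP.differentiable (by simp)
  -- the compact domain
  set A : Set E := {x | F x ≤ 0} with hA
  have hAc : IsCompact A :=
    hK.of_isClosed_subset (isClosed_le hF.continuous continuous_const)
      fun x hx => hKF x (le_trans hx hε₀.le)
  -- the starting time `τ₀ ≤ min_A (F + w) - δ`, `τ₀ ≤ 1`
  obtain ⟨τ₀, hτ₀1, hτ₀A⟩ : ∃ τ₀ : ℝ, τ₀ ≤ 1 ∧ ∀ x ∈ A, τ₀ ≤ F x + w x - δ := by
    by_cases hne : A.Nonempty
    · obtain ⟨x₀, hx₀, hmin⟩ :=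
        hAc.exists_isMinOn hne ((hF.continuous.add hw.continuous).continuousOn)
      exact ⟨min 1 (F x₀ + w x₀ - δ), min_le_left _ _, fun x hx =>
        (min_le_right _ _).trans (by have h' : F x₀ + w x₀ ≤ F x + w x := hmin hx; linarith)⟩
    · exact ⟨1, le_rfl, fun x hx => (hne ⟨x, hx⟩).elim⟩
  -- the family
  set T : ℝ → ℝ := fun σ => τ₀ + σ * (1 - τ₀) with hT
  have hT0 : T 0 = τ₀ := by simp [hT]
  have hT1 : T 1 = 1 := by simp [hT]
  have hTle : ∀ σ ∈ Icc (0 : ℝ) 1, T σ ≤ 1 := fun σ hσ => by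
    simp only [hT]; nlinarith [hσ.1, hσ.2]
  have hTge : ∀ σ ∈ Icc (0 : ℝ) 1, τ₀ ≤ T σ := fun σ hσ => by
    simp only [hT]; nlinarith [hσ.1, hσ.2]
  set G : ℝ × E → ℝ := fun p => F p.2 + δ * P ((T p.1 - w p.2 - F p.2) / δ) with hG
  have hTs : ContDiff ℝ ∞ T := (contDiff_const.add (contDiff_id.mul contDiff_const))
  have hGs : ContDiff ℝ ∞ G := by
    refine (hF.comp contDiff_snd).add (contDiff_const.mul (hP.comp ?_))
    exact (((hTs.comp contDiff_fst).sub (hw.comp contDiff_snd)).sub (hF.comp contDiff_snd)).div_const δ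
  -- `G ≥ F`
  have hGF : ∀ p : ℝ × E, F p.2 ≤ G p := fun p =>
    (le_max_left _ _).trans (max_le_smax hPge hδ (F p.2) (T p.1 - w p.2))
  -- hypotheses of the isotopy lemma
  have hKG : ∀ σ ∈ Icc (0 : ℝ) 1, ∀ x, |G (σ, x)| ≤ ε₀ → x ∈ K := fun σ _ x hx =>
    hKF x ((hGF (σ, x)).trans ((le_abs_self _).trans hx))
  have hreg : ∀ σ ∈ Icc (0 : ℝ) 1, ∀ x, G (σ, x) = 0 → fderiv ℝ (fun y => G (σ, y)) x ≠ 0 := by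
    intro σ hσ x hx0
    set τ := T σ with hτ
    set s : ℝ := (τ - w x - F x) / δ with hs
    have hderiv : HasFDerivAt (fun y => G (σ, y))
        ((1 - deriv P s) • fderiv ℝ F x + deriv P s • fderiv ℝ (fun y => τ - w y) x) x := by
      have h := hasFDerivAt_smax (P := P) (δ := δ) hPdiff hδ.ne' (F := F) (ℓ := fun y => τ - w y)
        (hF.differentiable (by simp) x).hasFDerivAt
        ((hw.differentiable (by simp) x).const_sub τ).hasFDerivAt.differentiableAt.hasFDerivAt
      simpa [hG, hs] using h
    have hDw : fderiv ℝ (fun y => τ - w y) x = -fderiv ℝ w x := by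
      rw [fderiv_const_sub]
    rw [hderiv.fderiv, hDw]
    have hG0 : F x + δ * P s = 0 := by simpa [hG, hs] using hx0
    -- case analysis on the position in the band
    rcases le_or_gt s (-1) with hs1 | hs1
    · -- `F_τ = F` near `x`: the derivative is `DF`
      rw [deriv_eq_zero_of_le hP0 hPge hs1]
      simp only [sub_zero, one_smul, zero_smul, add_zero]
      have hFx : F x = 0 := by rw [hP0 s hs1, mul_zero, add_zero] at hG0; exact hG0
      exact H1 x (by linarith) hFx.le
    rcases le_or_gt 1 s with hs2 | hs2
    · -- `F_τ = τ - w` near `x`: the derivative is `-Dw`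
      rw [deriv_eq_one_of_le hPdiff hP1 hPge hs2]
      simp only [sub_self, zero_smul, one_smul, zero_add, smul_neg, ne_eq, neg_eq_zero]
      have hm : τ - w x = 0 := by
        rw [hP1 s hs2, hs, mul_div_cancel₀ _ hδ.ne'] at hG0; linarith
      have hFle : F x ≤ 0 := by
        have : 1 ≤ (τ - w x - F x) / δ := hs2
        rw [le_div_iff₀ hδ] at this; linarith
      exact H2 x hFle (by linarith [hTle σ hσ])
    · -- in the band: both `F` and `τ - w` lie in `(-2δ, 0]`
      have hband : |τ - w x - F x| < δ := by
        rw [abs_lt]; constructor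
        · have : -1 < (τ - w x - F x) / δ := hs1
          rw [lt_div_iff₀ hδ] at this; linarith
        · have : (τ - w x - F x) / δ < 1 := hs2
          rw [div_lt_iff₀ hδ] at this; linarith
      obtain ⟨hF0, hm0⟩ := le_zero_of_smax_nonpos hPge hδ hG0.le
      have hmax : -δ ≤ max (F x) (τ - w x) := by
        have := smax_le_max_add hPle hδ (F x) (τ - w x)
        rw [← hs] at this
        linarith [hG0.ge, this]
      have hF2 : -(2 * δ) ≤ F x := by
        rcases le_total (F x) (τ - w x) with h | h
        · rw [max_eq_right h] at hmax; rw [abs_lt] at hband; linarith [hband.1]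
        · rw [max_eq_left h] at hmax; linarith
      have hw2 : w x ≤ 1 + 2 * δ := by
        rcases le_total (F x) (τ - w x) with h | h
        · rw [max_eq_right h] at hmax; linarith [hTle σ hσ]
        · rw [max_eq_left h] at hmax; rw [abs_lt] at hband; linarith [hband.2, hTle σ hσ]
      obtain ⟨hθ0, hθ1⟩ := hPd s
      set θ := deriv P s with hθ
      intro hzero
      rcases hθ0.eq_or_lt with h0 | h0
      · -- θ = 0
        rw [← h0] at hzero
        simp only [sub_zero, one_smul, zero_smul, add_zero] at hzero
        exact H1 x hF2 hF0 hzero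
      rcases hθ1.eq_or_lt' with h1 | h1
      · -- θ = 1
        rw [← h1] at hzero
        simp only [sub_self, zero_smul, one_smul, zero_add, smul_neg, neg_eq_zero] at hzero
        exact H2 x hF0 hw2 hzero
      · -- 0 < θ < 1: `Dw` is a positive multiple of `DF`
        have hc : fderiv ℝ w x = ((1 - θ) / θ) • fderiv ℝ F x := by
          have h' : θ • fderiv ℝ w x = (1 - θ) • fderiv ℝ F x := by
            rw [smul_neg, ← sub_eq_add_neg, sub_eq_zero] at hzero
            exact hzero.symm
          calc fderiv ℝ w x = θ⁻¹ • (θ • fderiv ℝ w x) := by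
                rw [smul_smul, inv_mul_cancel₀ h0.ne', one_smul]
            _ = θ⁻¹ • ((1 - θ) • fderiv ℝ F x) := by rw [h']
            _ = ((1 - θ) / θ) • fderiv ℝ F x := by rw [smul_smul, div_eq_inv_mul]
        exact H3 x hF2 hF0 hw2 ((1 - θ) / θ) (div_pos (by linarith) h0) hc
  -- the isotopy lemma
  obtain ⟨Φ, hle, heq, -, hfix, hKfix⟩ :=
    RegularFamily.exists_diffeomorph_image_eq hGs hK hε₀ hKG hreg
  -- the initial member defines `A` exactly
  have hG0_of_mem : ∀ x ∈ A, G (0, x) = F x := by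
    intro x hx
    simp only [hG, hT0]
    exact smax_eq_left hP0 hδ (by linarith [hτ₀A x hx])
  have hset0 : {x | G (0, x) ≤ 0} = {x | F x ≤ 0} := by
    ext x
    simp only [mem_setOf_eq]
    constructor
    · exact fun h => (hGF (0, x)).trans h
    · intro h; rw [hG0_of_mem x h]; exact h
  have hset0' : {x | G (0, x) = 0} = {x | F x = 0} := by
    ext x
    simp only [mem_setOf_eq]
    constructor
    · intro h
      have hxA : x ∈ A := (hGF (0, x)).trans h.le
      rw [← hG0_of_mem x hxA]; exact h
    · intro h; rw [hG0_of_mem x (le_of_eq h : F x ≤ 0)]; exact h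
  have hset1 : ∀ x, G (1, x) = F x + δ * P ((1 - w x - F x) / δ) := fun x => by
    simp only [hG, hT1]
  -- the time derivative vanishes where `w + F ≥ 1 + δ`
  have hstat : ∀ x, 1 + δ ≤ w x + F x → ∀ σ ∈ Icc (0 : ℝ) 1, fderiv ℝ G (σ, x) (1, 0) = 0 := by
    intro x hx σ hσ
    have hGd : DifferentiableAt ℝ G (σ, x) := hGs.differentiable (by simp) _
    have hc1 : HasDerivAt (fun σ' : ℝ => ((σ', x) : ℝ × E)) ((1 : ℝ), (0 : E)) σ :=
      (hasDerivAt_id σ).prodMk (hasDerivAt_const σ x)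
    have h1 : HasDerivAt (G ∘ fun σ' : ℝ => ((σ', x) : ℝ × E)) (fderiv ℝ G (σ, x) ((1 : ℝ), (0 : E))) σ :=
      hGd.hasFDerivAt.comp_hasDerivAt σ hc1
    -- direct computation of the same derivative
    set s : ℝ := (T σ - w x - F x) / δ with hs
    have hs1 : s ≤ -1 := by
      rw [hs, div_le_iff₀ hδ]; linarith [hTle σ hσ]
    have hTd : HasDerivAt T (1 - τ₀) σ := by
      have := ((hasDerivAt_id σ).mul_const (1 - τ₀)).const_add τ₀
      simpa [hT] using this
    have hinner : HasDerivAt (fun σ' => (T σ' - w x - F x) / δ) ((1 - τ₀) / δ) σ := by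
      have := ((hTd.sub_const (w x)).sub_const (F x)).div_const δ
      simpa using this
    have hP' : HasDerivAt P (deriv P s) s := (hPdiff s).hasDerivAt
    have h2 : HasDerivAt (fun σ' => F x + δ * P ((T σ' - w x - F x) / δ))
        (0 + δ * (deriv P s * ((1 - τ₀) / δ))) σ := by
      exact (hasDerivAt_const σ (F x)).add ((hP'.comp σ hinner).const_mul δ)
    have h12 : (G ∘ fun σ' : ℝ => ((σ', x) : ℝ × E)) =
        fun σ' => F x + δ * P ((T σ' - w x - F x) / δ) := by
      funext σ'; simp [hG]
    rw [h12] at h1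
    rw [h1.unique h2, deriv_eq_zero_of_le hP0 hPge hs1]
    simp
  refine ⟨Φ, ?_, ?_, fun x hx => hfix x (hstat x hx), hKfix⟩
  · rw [hA, ← hset0, hle]
    ext x; simp only [mem_setOf_eq, hset1]
  · rw [← hset0', heq]
    ext x; simp only [mem_setOf_eq, hset1]

end Sweep

end SmoothMax

end Literature.Topology.FourManifolds

end
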